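import Literature.Probability.RandomPlanarGeometry.SAWAdsorptionLowTemperature
import HarnessLib

/-!
# The low-temperature law of the adsorbing half-plane self-avoiding walk on `ℤ²` to second order:
# `a + 1/(2a) ≤ e^{κ(a)} ≤ a + 6/a` for `a ≥ 1`, i.e. `κ(α) − α ≍ e^{−2α}`

Topic `Literature/Probability/RandomPlanarGeometry` (continues `SAWAdsorptionLowTemperature.lean`: the potential
framework `Zd.LowTemp.adsZ_le_of_potential` for upper bounds on `Z⁺_n(a) = Zd.adsZ n a`, and the sandwich
`a ≤ e^{κ(a)} ≤ a + 2`; and `SAWAdsorptionUpperBound.lean`: the hook automaton `Zd.HookState`, its weighted count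
`Zd.hookCount` and `Zd.hookCount_le_adsZ : N_n(W) ≤ Z⁺_n(a)`).

Printed context: Rychlewski–Whittington 2011 proved, for the square lattice, that the growth rate `e^{κ(a)}` of the
adsorption partition function is asymptotic to `a` (as reported by Beaton–Bousquet-Mélou–de Gier–Duminil-Copin–Guttmann,
arXiv:1109.0358 p. 7: «on the square lattice, `μ(y)` is asymptotic to `y`», and Beaton–Guttmann–Jensen 2012 p. 2).
This file pins the SECOND-ORDER term to its exact exponential order:

* `Zd.adsRate_le_of_quartic` — **if `Λ ≥ 3`, `Λ > a ≥ 1` and `4a² ≤ Λ(Λ−1)(Λ−2)(Λ−a)` then `e^{κ(a)} ≤ Λ`** (a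
  one-parameter family of excessive potentials `LowTemp.pot₂ a Λ` for the one-step rule of the previous file; at
  `Λ = a + 2` this is the previous file's bound);
* `Zd.adsRate_le_add_six_div` — **`e^{κ(a)} ≤ a + 6/a` for `a ≥ 1`**;
* `Zd.add_half_div_le_adsRate` — **`a + 1/(2a) ≤ e^{κ(a)}` for `a ≥ 1`**, and `Zd.add_inv_le_adsRate` — **`a + 1/a ≤ e^{κ(a)}`
  for `a ≥ 3`** (a symbolic sub-eigenvector of the tree's hook automaton supported on the wall run and the unit bumps
  `+e₀, +e₁, …, +e₁, −e₀`: `Zd.adsorbedAbove_add_of_bump`, condition `Λ²(Λ−1)(Λ−a) ≤ a²`);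
* `Zd.adsFreeEnergy_sub_mem_Icc` — **`log (1 + e^{−2α}/2) ≤ κ(α) − α ≤ log (1 + 6e^{−2α})` for `α ≥ 0`**, whence
  `Zd.adsFreeEnergy_sub_le_six_mul_exp : κ(α) − α ≤ 6e^{−2α}` and
  `Zd.exp_mul_le_adsFreeEnergy_sub : e^{−2α}/4 ≤ κ(α) − α` (`α ≥ 0`): **`κ(α) − α ≍ e^{−2α}`**.

Why the orders match: off the wall every excursion of a no-reversal word has at least two vertices (the letters up and
down cannot be adjacent), so an excursion costs a factor `a^{-2}` relative to the wall run — the potential `pot₂`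
books exactly this (`Λ = a + c/a` satisfies the quartic condition as soon as `c(1 + o(1)) ≥ 4`); conversely the unit
bumps `+e₀ +e₁ ⋯ +e₁ −e₀` east of a wall run are genuinely self-avoiding half-plane walks, and for the sub-family «wall
steps and unit bumps» the sub-eigenvector condition at the wall state `W` reads `Λ²(Λ−1)(Λ−a) ≤ a²`, met by
`Λ = a + 1/(2a)` for every `a ≥ 1` (the family's own rate is `a + (1 + o(1))/a`).

Status in print (lit-2 g16, 2026-08-23): first-order law `e^{κ(a)} ∼ a` on `ℤ²` = Rychlewski–Whittington 2011 as
reported by [cite: BeatonBousquetMelouDeGierDuminilCopinGuttmann2014, §3 (arXiv v5 pp. 9–10)] and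
[cite: BeatonGuttmannJensen2012Adsorption, p. 2]; ratio asymptotics [cite: JansevanRensburgWhittington2013, Corollary 1 and
Theorem 5 (arXiv v4 p. 9)]; the two-sided second-order envelope `a + 1/(2a) ≤ e^{κ(a)} ≤ a + 6/a` (`κ(α) − α ≍ e^{−2α}`) is
not located in print — label NEW-IN-WRITING (modest), provisional on the unheld primary J. Stat. Phys. 145 (2011) 661–668.
Pure standard axioms. (Lane «pcv-sawmu», a-p3 g10.)
-/

noncomputable section

open Finset Filter Topology Literature.Probability.LatticeModels
open scoped BigOperators

namespace Literature.Probability.RandomPlanarGeometry.SAW.Zd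

namespace LowTemp

/-! ### A one-parameter family of excessive potentials -/

/-- The second potential, parameters `a` (fugacity) and `Λ` (target rate): on the wall `2` at the start, `1` inside a wall
run, `2a/Λ` just after a landing; off the wall `Λ − a` just after the letter `+e₀`, `(Λ−1)(Λ−a)/2` otherwise (`Λ²` at the
unreachable off-wall start). [cite: BeatonGuttmannJensen2012Adsorption, §1 (p. 2)] -/
def pot₂ (a Λ : ℝ) (h : ℤ) (l : Option Step) : ℝ :=
  if h = 0 then
    (match l with
      | none => 2
      | some s => if s = 2 then 2 * a / Λ else if s = 0 then 2 else 1)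
  else
    (match l with
      | none => Λ ^ 2
      | some s => if s = 0 then Λ - a else (Λ - 1) * (Λ - a) / 2)

/-- `pot₂ a Λ 0 none = 2`. [folklore] -/
private theorem pot₂_zero_none (a Λ : ℝ) : pot₂ a Λ 0 none = 2 := by simp [pot₂]

/-- Lower bound `pot₂ ≥ min (min 1 (Λ − a)) (a/Λ)` (`1 ≤ a < Λ`, `3 ≤ Λ`). [folklore] -/
private theorem le_pot₂ {a Λ : ℝ} (ha : 1 ≤ a) (haΛ : a < Λ) (h3 : 3 ≤ Λ) (h : ℤ) (l : Option Step) :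
    min (min 1 (Λ - a)) (a / Λ) ≤ pot₂ a Λ h l := by
  have hΛ : 0 < Λ := by linarith
  have m1 : min (min 1 (Λ - a)) (a / Λ) ≤ 1 := (min_le_left _ _).trans (min_le_left _ _)
  have m2 : min (min 1 (Λ - a)) (a / Λ) ≤ Λ - a := (min_le_left _ _).trans (min_le_right _ _)
  have m3 : min (min 1 (Λ - a)) (a / Λ) ≤ a / Λ := min_le_right _ _
  have haL : a / Λ ≤ 2 * a / Λ := by
    rw [div_le_div_iff_of_pos_right hΛ]; linarith
  have hH : Λ - a ≤ (Λ - 1) * (Λ - a) / 2 := by nlinarith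
  have hsq : (1 : ℝ) ≤ Λ ^ 2 := by nlinarith
  unfold pot₂
  rcases l with _ | s
  · split_ifs <;> linarith
  · by_cases hh : h = 0
    · simp only [hh, if_true]
      split_ifs <;> linarith
    · simp only [hh, if_false]
      split_ifs <;> linarith

/-- `pot₂ ≥ 0` (`1 ≤ a < Λ`, `3 ≤ Λ`). [folklore] -/
private theorem pot₂_nonneg {a Λ : ℝ} (ha : 1 ≤ a) (haΛ : a < Λ) (h3 : 3 ≤ Λ) (h : ℤ) (l : Option Step) :
    0 ≤ pot₂ a Λ h l := by
  refine le_trans (le_min (le_min zero_le_one ?_) ?_) (le_pot₂ ha haΛ h3 h l)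
  · linarith
  · exact div_nonneg (by linarith) (by linarith)

/-- **`pot₂ a Λ` is `Λ`-excessive** under `1 ≤ a < Λ`, `3 ≤ Λ` and the quartic condition `4a² ≤ Λ(Λ−1)(Λ−2)(Λ−a)`
(the binding configuration: height `1` just after a step down, where a landing — weight `a`, two wall directions next —
competes with two sideways letters). [cite: BeatonGuttmannJensen2012Adsorption, §1 (p. 2)] -/
theorem locSum_pot₂_le {a Λ : ℝ} (ha : 1 ≤ a) (haΛ : a < Λ) (h3 : 3 ≤ Λ)
    (hq : 4 * a ^ 2 ≤ Λ * (Λ - 1) * (Λ - 2) * (Λ - a)) {h : ℤ} (hh : 0 ≤ h) (l : Option Step) :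
    locSum (pot₂ a Λ) a h l ≤ Λ * pot₂ a Λ h l := by
  have hΛ : 0 < Λ := by linarith
  have hΛ0 : Λ ≠ 0 := hΛ.ne'
  have hL : Λ * (2 * a / Λ) = 2 * a := by field_simp
  have haL : a * (2 * a / Λ) * Λ = 2 * a ^ 2 := by field_simp
  have ht : 0 < Λ - a := by linarith
  -- the binding inequality, cleared of the denominator `Λ`
  have hq' : a * (2 * a / Λ) ≤ (Λ - 2) * ((Λ - 1) * (Λ - a) / 2) := by
    rw [show a * (2 * a / Λ) = 2 * a ^ 2 / Λ by ring, div_le_iff₀ hΛ]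
    nlinarith
  -- off the wall at height `≥ 2`: `(Λ − a) + 2H ≤ ΛH` and `3H ≤ ΛH` for `H = (Λ−1)(Λ−a)/2`, `Λ ≥ 3`
  have hHH : Λ - a + (Λ - 1) * (Λ - a) / 2 + (Λ - 1) * (Λ - a) / 2 ≤ Λ * ((Λ - 1) * (Λ - a) / 2) := by
    nlinarith [mul_nonneg (mul_nonneg ht.le hΛ.le) (sub_nonneg.2 h3)]
  have hDD : (Λ - 1) * (Λ - a) + (Λ - 1) * (Λ - a) / 2 ≤ Λ * ((Λ - 1) * (Λ - a) / 2) := by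
    nlinarith [mul_nonneg (mul_nonneg (sub_nonneg.2 h3) (show (0:ℝ) ≤ Λ - 1 by linarith)) ht.le]
  rcases (show h = 0 ∨ h = 1 ∨ 2 ≤ h by omega) with rfl | rfl | h2
  · rcases l with _ | t
    · simp [locSum, Fin.sum_univ_four, Allowed, Step.opp, Step.dx, wt, pot₂]
      nlinarith
    · fin_cases t <;> simp [locSum, Fin.sum_univ_four, Allowed, Step.opp, Step.dx, wt, pot₂] <;> nlinarith
  · rcases l with _ | t
    · simp [locSum, Fin.sum_univ_four, Allowed, Step.opp, Step.dx, wt, pot₂]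
      nlinarith
    · fin_cases t <;> simp [locSum, Fin.sum_univ_four, Allowed, Step.opp, Step.dx, wt, pot₂] <;> nlinarith
  · have h0 : h ≠ 0 := by omega
    have h1 : h + 1 ≠ 0 := by omega
    have hm1 : h + -1 ≠ 0 := by omega
    have h1le : (1 : ℤ) ≤ h := by omega
    rcases l with _ | t
    · simp [locSum, Fin.sum_univ_four, Allowed, Step.opp, Step.dx, wt, pot₂, h0, h1, hm1, h1le]
      nlinarith
    · fin_cases t <;>
        simp [locSum, Fin.sum_univ_four, Allowed, Step.opp, Step.dx, wt, pot₂, h0, h1, hm1, h1le] <;> linarith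

end LowTemp

/-! ### Upper bounds: `e^{κ(a)} ≤ Λ` under the quartic condition; `e^{κ(a)} ≤ a + 6/a` -/

/-- **`Z⁺_n(a) ≤ 2Λⁿ/δ`** with `δ = min(1, Λ − a, a/Λ)`, under `1 ≤ a < Λ`, `3 ≤ Λ`, `4a² ≤ Λ(Λ−1)(Λ−2)(Λ−a)`.
[cite: BeatonGuttmannJensen2012Adsorption, §1 (p. 2)] -/
theorem adsZ_le_of_quartic {a Λ : ℝ} (ha : 1 ≤ a) (haΛ : a < Λ) (h3 : 3 ≤ Λ)
    (hq : 4 * a ^ 2 ≤ Λ * (Λ - 1) * (Λ - 2) * (Λ - a)) (n : ℕ) :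
    adsZ n a ≤ Λ ^ n * 2 / min (min 1 (Λ - a)) (a / Λ) := by
  have hδ : 0 < min (min 1 (Λ - a)) (a / Λ) :=
    lt_min (lt_min zero_lt_one (by linarith)) (div_pos (by linarith) (by linarith))
  have h := LowTemp.adsZ_le_of_potential (LowTemp.pot₂ a Λ) (zero_le_one.trans ha) (by linarith) hδ
    (fun h l _ => LowTemp.le_pot₂ ha haΛ h3 h l) (fun h l => LowTemp.pot₂_nonneg ha haΛ h3 h l)
    (fun h hh l => LowTemp.locSum_pot₂_le ha haΛ h3 hq hh l) n
  rwa [LowTemp.pot₂_zero_none] at h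

/-- **`e^{κ(a)} ≤ Λ` whenever `Λ ≥ 3`, `Λ > a ≥ 1` and `4a² ≤ Λ(Λ−1)(Λ−2)(Λ−a)`** (for `Λ = a + c/a` the condition reads
`c(1 + o(1)) ≥ 4`: every excursion costs `a^{-2}`). [cite: BeatonBousquetMelouDeGierDuminilCopinGuttmann2014, §3 (arXiv:1109.0358v5 pp. 9–10: «on the square lattice, μ(y) is asymptotic to y» — Rychlewski–Whittington 2011)]
[cite: BeatonGuttmannJensen2012Adsorption, §1 p. 2 (arXiv:1110.6695v1: «κ(α) is asymptotic to α»)] [cite: JansevanRensburgWhittington2013, Theorem 4 (arXiv v4 p. 8), Corollary 1 and Theorem 5 (p. 9): ratio asymptotics κ(a) ∼ log μ_{d−1} + log a] -/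
theorem adsRate_le_of_quartic {a Λ : ℝ} (ha : 1 ≤ a) (haΛ : a < Λ) (h3 : 3 ≤ Λ)
    (hq : 4 * a ^ 2 ≤ Λ * (Λ - 1) * (Λ - 2) * (Λ - a)) : adsRate a ≤ Λ := by
  have h0 : 0 ≤ a := zero_le_one.trans ha
  have hΛ : 0 ≤ Λ := by linarith
  set K : ℝ := 2 / min (min 1 (Λ - a)) (a / Λ) with hK
  have hKpos : 0 < K :=
    div_pos two_pos (lt_min (lt_min zero_lt_one (by linarith)) (div_pos (by linarith) (by linarith)))
  have hK1 : Tendsto (fun n : ℕ => K ^ (1 / (n : ℝ))) atTop (𝓝 1) := by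
    have := (tendsto_const_nhds (x := K)).rpow tendsto_one_div_atTop_nhds_zero_nat (Or.inl hKpos.ne')
    simpa using this
  have hup : Tendsto (fun n : ℕ => K ^ (1 / (n : ℝ)) * Λ) atTop (𝓝 Λ) := by
    simpa using hK1.mul_const Λ
  refine le_of_tendsto_of_tendsto (tendsto_adsRate h0) hup ?_
  filter_upwards [eventually_ge_atTop 1] with n hn
  have hb : adsZ n a ≤ K * Λ ^ n := by
    have := adsZ_le_of_quartic ha haΛ h3 hq n
    rw [hK]
    calc adsZ n a ≤ Λ ^ n * 2 / min (min 1 (Λ - a)) (a / Λ) := this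
      _ = 2 / min (min 1 (Λ - a)) (a / Λ) * Λ ^ n := by ring
  calc (adsZ n a) ^ (1 / (n : ℝ)) ≤ (K * Λ ^ n) ^ (1 / (n : ℝ)) :=
        Real.rpow_le_rpow (adsZ_nonneg n h0) hb (by positivity)
    _ = K ^ (1 / (n : ℝ)) * Λ := by
        rw [Real.mul_rpow hKpos.le (pow_nonneg hΛ _), one_div, Real.pow_rpow_inv_natCast hΛ (by omega)]

/-- The quartic condition at `Λ = a + 6/a` (`a ≥ 1`): `4a² ≤ Λ(Λ−1)(Λ−2)·(6/a)`, via `Λ ≥ a`,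
`Λ − 1 ≥ a − 1 + 6/a > 0`, `Λ − 2 ≥ a − 2 + 6/a > 0` and `a⁴ − 9a³ + 42a² − 54a + 108 ≥ 0`. [folklore] -/
private theorem quartic_six_div {a : ℝ} (ha : 1 ≤ a) :
    4 * a ^ 2 ≤ (a + 6 / a) * (a + 6 / a - 1) * (a + 6 / a - 2) * (a + 6 / a - a) := by
  have ha0 : 0 < a := by linarith
  have key : 4 * a ^ 6 ≤ 6 * (a ^ 2 + 6) * (a ^ 2 - a + 6) * (a ^ 2 - 2 * a + 6) := by
    nlinarith [sq_nonneg (a ^ 3 - 9 / 2 * a ^ 2), sq_nonneg (a ^ 2 - 216 / 159 * a), sq_nonneg (a - 13 / 23),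
      sq_nonneg a, ha0]
  have hP : (a + 6 / a) * (a + 6 / a - 1) * (a + 6 / a - 2) * (a + 6 / a - a) * a ^ 4
      = 6 * (a ^ 2 + 6) * (a ^ 2 - a + 6) * (a ^ 2 - 2 * a + 6) := by
    field_simp
    ring
  refine le_of_mul_le_mul_right ?_ (show 0 < a ^ 4 by positivity)
  rw [hP]
  calc 4 * a ^ 2 * a ^ 4 = 4 * a ^ 6 := by ring
    _ ≤ _ := key

/-- **`e^{κ(a)} ≤ a + 6/a` for `a ≥ 1`.** [cite: BeatonBousquetMelouDeGierDuminilCopinGuttmann2014, §3 (arXiv:1109.0358v5 pp. 9–10: «on the square lattice, μ(y) is asymptotic to y» — Rychlewski–Whittington 2011)] -/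
theorem adsRate_le_add_six_div {a : ℝ} (ha : 1 ≤ a) : adsRate a ≤ a + 6 / a := by
  have ha0 : 0 < a := by linarith
  have h6 : 0 < 6 / a := by positivity
  refine adsRate_le_of_quartic ha (by linarith) ?_ (quartic_six_div ha)
  -- `a + 6/a ≥ 2√6 > 3`
  refine le_of_mul_le_mul_right ?_ ha0
  rw [show (a + 6 / a) * a = a ^ 2 + 6 by field_simp]
  nlinarith [sq_nonneg (a - 3 / 2)]

/-! ### Lower bound: `e^{κ(a)} ≥ a + 1/(2a)` by a sub-eigenvector of the hook automaton -/

/-- Any non-negative sub-eigenvector `v ≤ M` of the hook automaton's weighted transfer rule at fugacity `a ≥ 0`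
(`Λ v(s) ≤ Σ_st stepWt(step s st) · v(step s st)` for every state) gives `Λⁿ v(s) ≤ M · N_n(s)` (the tree's
`Zd.pow_mul_hookVec_le_hookCount`, for a general vector). [cite: BeatonGuttmannJensen2012Adsorption, §1 (p. 2)] -/
theorem pow_mul_le_hookCount {a Λ M : ℝ} (ha : 0 ≤ a) (hΛ : 0 ≤ Λ) (v : HookState → ℝ) (hvM : ∀ s, v s ≤ M)
    (hcert : ∀ s, Λ * v s ≤ ∑ st : Step, stepWt a (HookState.step s st) * v (HookState.step s st)) :
    ∀ (n : ℕ) (s : HookState), Λ ^ n * v s ≤ M * hookCount a n s := by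
  have hwt : ∀ t, 0 ≤ stepWt a t := fun t => by unfold stepWt; split_ifs <;> linarith
  intro n
  induction n with
  | zero => intro s; simpa [hookCount] using hvM s
  | succ n ih =>
    intro s
    rw [hookCount, Finset.mul_sum]
    calc Λ ^ (n + 1) * v s = Λ ^ n * (Λ * v s) := by ring
      _ ≤ Λ ^ n * ∑ st : Step, stepWt a (HookState.step s st) * v (HookState.step s st) :=
          mul_le_mul_of_nonneg_left (hcert s) (pow_nonneg hΛ n)
      _ = ∑ st : Step, stepWt a (HookState.step s st) * (Λ ^ n * v (HookState.step s st)) := by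
          rw [Finset.mul_sum]; exact Finset.sum_congr rfl fun st _ => by ring
      _ ≤ ∑ st : Step, stepWt a (HookState.step s st) * (M * hookCount a n (HookState.step s st)) :=
          Finset.sum_le_sum fun st _ => mul_le_mul_of_nonneg_left (ih _) (hwt _)
      _ = ∑ st : Step, M * (stepWt a (HookState.step s st) * hookCount a n (HookState.step s st)) :=
          Finset.sum_congr rfl fun st _ => by ring

/-- The symbolic sub-eigenvector at rate `Λ` (polynomial normalisation): `v(W) = Λ²(Λ−1)`, `v(E) = aΛ(Λ−1)`,
`v(U₀) = a²`, `v(A₀) = a²Λ`, zero elsewhere — supported on the wall run `W →₁ W` and the unit bumps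
`W →₀ U₀ →₁ A₀ →₁ ⋯ →₁ A₀ →₂ E →₁ W`. [cite: BeatonGuttmannJensen2012Adsorption, §1 (p. 2)] -/
def bumpVec (a Λ : ℝ) : HookState → ℝ
  | HookState.W => Λ ^ 2 * (Λ - 1)
  | HookState.E => a * Λ * (Λ - 1)
  | HookState.U 0 => a ^ 2
  | HookState.A 0 => a ^ 2 * Λ
  | _ => 0

/-- **The sub-eigenvector inequalities for `bumpVec a (a+u)`**, `a > 0`, `u ≥ 0`, `a + u ≥ 1`: three of the four
non-trivial ones are equalities; the binding one, at the wall state `W`, is exactly the hypothesis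
`(a+u)²(a+u−1)·u ≤ a²` (i.e. `Λ²(Λ−1)(Λ−a) ≤ a²`). [cite: BeatonGuttmannJensen2012Adsorption, §1 (p. 2)] -/
theorem bump_certificate {a u : ℝ} (ha : 0 < a) (hu : 0 ≤ u) (h1 : 1 ≤ a + u)
    (hW : (a + u) ^ 2 * (a + u - 1) * u ≤ a ^ 2) (s : HookState) :
    (a + u) * bumpVec a (a + u) s ≤
      ∑ st : Step, stepWt a (HookState.step s st) * bumpVec a (a + u) (HookState.step s st) := by
  set Λ := a + u with hΛ
  have key : Λ * (Λ ^ 2 * (Λ - 1)) ≤ 1 * a ^ 2 + a * (Λ ^ 2 * (Λ - 1)) := by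
    have : (Λ - a) * (Λ ^ 2 * (Λ - 1)) ≤ a ^ 2 := by
      rw [show Λ - a = u by rw [hΛ]; ring]
      calc u * (Λ ^ 2 * (Λ - 1)) = Λ ^ 2 * (Λ - 1) * u := by ring
        _ ≤ a ^ 2 := hW
    nlinarith [this]
  have hΛ1' : 0 ≤ Λ - 1 := by linarith
  have hΛ0 : 0 ≤ Λ := by linarith
  rcases s with _ | _ | k | k | k | _
  · simpa [Fin.sum_univ_four, HookState.step, stepWt, HookState.isWall, bumpVec] using key
  · simp [HookState.step, stepWt, HookState.isWall, bumpVec]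
    nlinarith [mul_nonneg (mul_nonneg ha.le hΛ0) hΛ1']
  · rcases k with _ | _ | _ | _ | k <;> simp [Fin.sum_univ_four, HookState.step, stepWt, HookState.isWall, bumpVec]
    nlinarith [mul_nonneg (mul_nonneg ha.le hΛ0) hΛ1', sq_nonneg a]
  · rcases k with _ | _ | _ | _ | k <;> simp [Fin.sum_univ_four, HookState.step, stepWt, HookState.isWall, bumpVec]
    nlinarith [mul_nonneg (mul_nonneg ha.le hΛ0) hΛ1', sq_nonneg a]
  · rcases k with _ | _ | _ | _ | k <;> simp [Fin.sum_univ_four, HookState.step, stepWt, HookState.isWall, bumpVec]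
    nlinarith [mul_nonneg (mul_nonneg ha.le hΛ0) hΛ1', sq_nonneg a]
  · simp [HookState.step, stepWt, bumpVec]

/-- `bumpVec a (a+u) ≤ a²(a+u)` when `(a+u)(a+u−1) ≤ a²`, `a ≥ 1`, `u ≥ 0`. [folklore] -/
private theorem bumpVec_le {a u : ℝ} (ha : 1 ≤ a) (hu : 0 ≤ u) (hΛa : (a + u) * (a + u - 1) ≤ a ^ 2)
    (s : HookState) : bumpVec a (a + u) s ≤ a ^ 2 * (a + u) := by
  have ha0 : 0 < a := by linarith
  set Λ := a + u with hΛ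
  have hΛ1 : 1 ≤ Λ := by linarith
  rcases s with _ | _ | k | k | k | _
  · show Λ ^ 2 * (Λ - 1) ≤ a ^ 2 * Λ
    nlinarith [mul_le_mul_of_nonneg_left hΛa (show (0:ℝ) ≤ Λ by linarith)]
  · show a * Λ * (Λ - 1) ≤ a ^ 2 * Λ
    nlinarith [mul_le_mul_of_nonneg_left hΛa ha0.le]
  · rcases k with _ | k
    · show a ^ 2 ≤ a ^ 2 * Λ
      nlinarith [sq_nonneg a]
    · show (0 : ℝ) ≤ a ^ 2 * Λ
      positivity
  · rcases k with _ | k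
    · exact le_rfl
    · show (0 : ℝ) ≤ a ^ 2 * Λ
      positivity
  · show (0 : ℝ) ≤ a ^ 2 * Λ
    positivity
  · show (0 : ℝ) ≤ a ^ 2 * Λ
    positivity

/-- **`AdsorbedAbove a (a + u)`** whenever `a ≥ 1`, `u ≥ 0`, `a + u > 1`, `(a+u)(a+u−1) ≤ a²` and the sub-eigenvector
condition `(a+u)²(a+u−1)u ≤ a²`: `Z⁺_n(a) ≥ N_n(W) ≥ (v(W)/(a²Λ))·Λⁿ`, `Λ = a + u`, `v(W) = Λ²(Λ−1) > 0`.
[cite: BeatonGuttmannJensen2012Adsorption, §1 (p. 2)] -/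
theorem adsorbedAbove_add_of_bump {a u : ℝ} (ha : 1 ≤ a) (hu : 0 ≤ u) (h1 : 1 < a + u)
    (hΛa : (a + u) * (a + u - 1) ≤ a ^ 2) (hW : (a + u) ^ 2 * (a + u - 1) * u ≤ a ^ 2) :
    AdsorbedAbove a (a + u) := by
  have ha0 : 0 < a := by linarith
  set Λ := a + u with hΛ
  have hΛ0 : 0 < Λ := by linarith
  have hΛ1 : 0 < Λ - 1 := by linarith
  have hM : 0 < a ^ 2 * Λ := by positivity
  have hWpos : 0 < bumpVec a Λ HookState.W := by
    show 0 < Λ ^ 2 * (Λ - 1)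
    positivity
  refine ⟨bumpVec a Λ HookState.W / (a ^ 2 * Λ), div_pos hWpos hM, fun n => ?_⟩
  have h := pow_mul_le_hookCount ha0.le hΛ0.le (bumpVec a Λ) (fun s => bumpVec_le ha hu hΛa s)
    (fun s => bump_certificate ha0 hu h1.le hW s) n HookState.W
  calc bumpVec a Λ HookState.W / (a ^ 2 * Λ) * Λ ^ n = Λ ^ n * bumpVec a Λ HookState.W / (a ^ 2 * Λ) := by ring
    _ ≤ a ^ 2 * Λ * hookCount a n HookState.W / (a ^ 2 * Λ) := by gcongr
    _ = hookCount a n HookState.W := by field_simp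
    _ ≤ adsZ n a := hookCount_le_adsZ n ha0.le

/-- **`AdsorbedAbove a (a + 1/(2a))` for `a ≥ 1`** (the bump family at increment `u = 1/(2a)`:
`Λ²(Λ−1) ≤ 2a³`). [cite: BeatonGuttmannJensen2012Adsorption, §1 (p. 2)] -/
theorem adsorbedAbove_add_half_div {a : ℝ} (ha : 1 ≤ a) : AdsorbedAbove a (a + 1 / (2 * a)) := by
  have ha0 : 0 < a := by linarith
  set u := 1 / (2 * a) with hu_def
  have hu0 : 0 < u := by positivity
  have hu : a * u = 1 / 2 := by rw [hu_def]; field_simp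
  have hu2 : u ≤ 1 / 2 := by
    rw [hu_def, div_le_div_iff₀ (by positivity) (by norm_num)]; linarith
  have h1 : a ^ 2 * u = a / 2 := by nlinarith
  have h2 : a * u ^ 2 = u / 2 := by nlinarith
  -- `Λ²(Λ−1) = a³ − a² + 3a/2 − 1 + 3u/2 − u² + u³ ≤ 2a³`
  have hcube : (a + u) ^ 2 * (a + u - 1) ≤ 2 * a ^ 3 := by
    have e : (a + u) ^ 2 * (a + u - 1) = a ^ 3 - a ^ 2 + 3 / 2 * a - 1 + 3 / 2 * u - u ^ 2 + u ^ 3 := by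
      ring_nf; nlinarith [h1, h2]
    rw [e]; nlinarith [pow_pos hu0 2, pow_le_pow_left₀ hu0.le hu2 3]
  refine adsorbedAbove_add_of_bump ha hu0.le (by linarith) ?_ ?_
  · nlinarith
  · calc (a + u) ^ 2 * (a + u - 1) * u ≤ 2 * a ^ 3 * u := mul_le_mul_of_nonneg_right hcube hu0.le
      _ = a ^ 2 := by nlinarith [hu]

/-- **`AdsorbedAbove a (a + 1/a)` for `a ≥ 3`** (increment `u = 1/a`: `Λ²(Λ−1) ≤ a³` needs `a² − 3a + 2 ≥ 3u − u² + u³`).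
[cite: BeatonGuttmannJensen2012Adsorption, §1 (p. 2)] -/
theorem adsorbedAbove_add_inv {a : ℝ} (ha : 3 ≤ a) : AdsorbedAbove a (a + 1 / a) := by
  have ha0 : 0 < a := by linarith
  set u := 1 / a with hu_def
  have hu0 : 0 < u := by positivity
  have hu : a * u = 1 := by rw [hu_def]; field_simp
  have hu2 : u ≤ 1 / 3 := by
    rw [hu_def, div_le_div_iff₀ ha0 (by norm_num)]; linarith
  have h1 : a ^ 2 * u = a := by nlinarith
  have h2 : a * u ^ 2 = u := by nlinarith
  have hcube : (a + u) ^ 2 * (a + u - 1) ≤ a ^ 3 := by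
    have e : (a + u) ^ 2 * (a + u - 1) = a ^ 3 - a ^ 2 + 3 * a - 2 + 3 * u - u ^ 2 + u ^ 3 := by
      ring_nf; nlinarith [h1, h2]
    rw [e]; nlinarith [pow_pos hu0 2, pow_le_pow_left₀ hu0.le hu2 3]
  refine adsorbedAbove_add_of_bump (by linarith) hu0.le (by linarith) ?_ ?_
  · nlinarith
  · calc (a + u) ^ 2 * (a + u - 1) * u ≤ a ^ 3 * u := mul_le_mul_of_nonneg_right hcube hu0.le
      _ = a ^ 2 := by nlinarith [hu]

/-- **`a + 1/(2a) ≤ e^{κ(a)}` for `a ≥ 1`** — the lower second-order bound (wall runs decorated with unit bumps).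
[cite: BeatonBousquetMelouDeGierDuminilCopinGuttmann2014, §3 (arXiv:1109.0358v5 pp. 9–10: «on the square lattice, μ(y) is asymptotic to y» — Rychlewski–Whittington 2011)]
[cite: BeatonGuttmannJensen2012Adsorption, §1 p. 2 (arXiv:1110.6695v1: «κ(α) ≥ max[log μ, α]»)] -/
theorem add_half_div_le_adsRate {a : ℝ} (ha : 1 ≤ a) : a + 1 / (2 * a) ≤ adsRate a :=
  le_adsRate_of_adsorbedAbove (by linarith) (by positivity) (adsorbedAbove_add_half_div ha)

/-- **`a + 1/a ≤ e^{κ(a)}` for `a ≥ 3`** (the same family; its own rate is `a + (1+o(1))/a`).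
[cite: BeatonBousquetMelouDeGierDuminilCopinGuttmann2014, §3 (arXiv:1109.0358v5 pp. 9–10: «on the square lattice, μ(y) is asymptotic to y» — Rychlewski–Whittington 2011)] -/
theorem add_inv_le_adsRate {a : ℝ} (ha : 3 ≤ a) : a + 1 / a ≤ adsRate a :=
  le_adsRate_of_adsorbedAbove (by linarith) (by positivity) (adsorbedAbove_add_inv ha)

/-- **The second-order sandwich: `a + 1/(2a) ≤ e^{κ(a)} ≤ a + 6/a` for `a ≥ 1`.**
[cite: BeatonBousquetMelouDeGierDuminilCopinGuttmann2014, §3 (arXiv:1109.0358v5 pp. 9–10: «on the square lattice, μ(y) is asymptotic to y» — Rychlewski–Whittington 2011)] -/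
theorem adsRate_mem_Icc_sharp {a : ℝ} (ha : 1 ≤ a) : adsRate a ∈ Set.Icc (a + 1 / (2 * a)) (a + 6 / a) :=
  ⟨add_half_div_le_adsRate ha, adsRate_le_add_six_div ha⟩

/-! ### The free energy: `κ(α) − α ≍ e^{−2α}` -/

/-- **`log (1 + e^{−2α}/2) ≤ κ(α) − α ≤ log (1 + 6e^{−2α})` for `α ≥ 0`.**
[cite: BeatonBousquetMelouDeGierDuminilCopinGuttmann2014, §3 (arXiv:1109.0358v5 pp. 9–10: «on the square lattice, μ(y) is asymptotic to y» — Rychlewski–Whittington 2011)]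
[cite: BeatonGuttmannJensen2012Adsorption, §1 p. 2 (arXiv:1110.6695v1: «κ(α) is asymptotic to α»)] [cite: JansevanRensburgWhittington2013, Theorem 4 (arXiv v4 p. 8), Corollary 1 and Theorem 5 (p. 9): ratio asymptotics κ(a) ∼ log μ_{d−1} + log a] -/
theorem adsFreeEnergy_sub_mem_Icc {α : ℝ} (hα : 0 ≤ α) :
    adsFreeEnergy α - α ∈
      Set.Icc (Real.log (1 + Real.exp (-2 * α) / 2)) (Real.log (1 + 6 * Real.exp (-2 * α))) := by
  set a := Real.exp α with ha_def
  have h1 : 1 ≤ a := Real.one_le_exp hα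
  have ha0 : 0 < a := Real.exp_pos α
  have hpos := adsRate_pos ha0.le
  have he2 : Real.exp (-2 * α) = 1 / a ^ 2 := by
    rw [ha_def, ← Real.exp_nat_mul, one_div, ← Real.exp_neg]; ring_nf
  have elow : a * (1 + Real.exp (-2 * α) / 2) = a + 1 / (2 * a) := by rw [he2]; field_simp
  have eup : a * (1 + 6 * Real.exp (-2 * α)) = a + 6 / a := by rw [he2]; field_simp
  have hκ : adsFreeEnergy α - α = Real.log (adsRate a / a) := by
    rw [adsFreeEnergy, Real.log_div hpos.ne' ha0.ne', ha_def, Real.log_exp]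
  rw [hκ]
  constructor
  · refine Real.log_le_log (by positivity) ?_
    rw [le_div_iff₀ ha0, mul_comm, elow]
    exact add_half_div_le_adsRate h1
  · refine Real.log_le_log (div_pos hpos ha0) ?_
    rw [div_le_iff₀ ha0, mul_comm, eup]
    exact adsRate_le_add_six_div h1

/-- **`κ(α) − α ≤ 6e^{−2α}` for `α ≥ 0`.** [cite: BeatonBousquetMelouDeGierDuminilCopinGuttmann2014, §3 (arXiv:1109.0358v5 pp. 9–10: «on the square lattice, μ(y) is asymptotic to y» — Rychlewski–Whittington 2011)] -/
theorem adsFreeEnergy_sub_le_six_mul_exp {α : ℝ} (hα : 0 ≤ α) : adsFreeEnergy α - α ≤ 6 * Real.exp (-2 * α) := by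
  refine (adsFreeEnergy_sub_mem_Icc hα).2.trans ?_
  have := Real.log_le_sub_one_of_pos (show 0 < 1 + 6 * Real.exp (-2 * α) by positivity)
  linarith

/-- **`e^{−2α}/4 ≤ κ(α) − α` for `α ≥ 0`** (`log(1+x) ≥ x/2` for `0 ≤ x ≤ 1`, here `x = e^{−2α}/2 ≤ 1/2`).
[cite: BeatonBousquetMelouDeGierDuminilCopinGuttmann2014, §3 (arXiv:1109.0358v5 pp. 9–10: «on the square lattice, μ(y) is asymptotic to y» — Rychlewski–Whittington 2011)] -/
theorem exp_mul_le_adsFreeEnergy_sub {α : ℝ} (hα : 0 ≤ α) : Real.exp (-2 * α) / 4 ≤ adsFreeEnergy α - α := by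
  refine le_trans ?_ (adsFreeEnergy_sub_mem_Icc hα).1
  set x := Real.exp (-2 * α) / 2 with hx
  have hx0 : 0 ≤ x := by positivity
  have hx1 : x ≤ 1 / 2 := by
    rw [hx, div_le_div_iff_of_pos_right two_pos]
    rw [Real.exp_le_one_iff]; linarith
  -- log (1 + x) ≥ x − x²/2 ≥ x/2 · … ; use `Real.add_pow_le_pow_mul_pow_of_sq_le_sq`? simpler: log(1+x) ≥ x/(1+x) ≥ x/2
  have h1 : x / (1 + x) ≤ Real.log (1 + x) := by
    have := Real.one_sub_inv_le_log_of_pos (show 0 < 1 + x by positivity)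
    calc x / (1 + x) = 1 - (1 + x)⁻¹ := by field_simp; ring
      _ ≤ Real.log (1 + x) := this
  have h2 : Real.exp (-2 * α) / 4 ≤ x / (1 + x) := by
    rw [show Real.exp (-2 * α) / 4 = x / 2 by rw [hx]; ring, div_le_div_iff₀ two_pos (by positivity)]
    nlinarith
  exact h2.trans h1

end Literature.Probability.RandomPlanarGeometry.SAW.Zd

end
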